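import Mathlib
import HarnessLib
import Summits.HubbardSuperconductivity.HubbardSuperconductivity.Theorems.KLProgrammeKLRegimeTwoVolumeSrcTowerIdentity
import Summits.HubbardSuperconductivity.HubbardSuperconductivity.Theorems.KLProgrammeKLRegimeTwoVolumeTopFrameGridDataAt

/-!
# Route `KLProgramme` — crux K3, VL child `KLRegimeVolumeLimitV17F2` (stmt-HubbardSuperconductivity-20440), blueprint v5 §1 BASE: THE FIRST DOUBLED OBJECT IS ONE
# BLOCK SUBSTITUTION OF THE TRIVIALLY DOUBLED UV-STEPPED GRID ACTION (seat hubbard-kl-k3c4-p1 g12; `--supports` 20440)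

The doubled tower (`…TwoVolumeSrcTowerIdentity`) starts at `D_1 := map (toLin' (ε • klSrcAnalysisAt … 0)) 𝒱_1[K]` — the scale-`1` action analysed by `F_0`
(plateau `{t ≤ Λ_1}` ⊃ the slice `(Λ_2, Λ_1]`) plus the plain source copy.  The UV end of the flow in the grid presentation is k3c4-p2's
`klEffectiveAction_eq_map_gridSub` (p590099): `𝒱_1[K] = map (toLin' S_N) Y_1`, `Y_1 := effAction (S_NᵀC^K_{>Λ_1}S_N) (V_N + 𝒩_K)` on the grid legs
`GridLeg (GridPoint V N)`, `N = 4M` — the object of M4a (`…TwoVolumeScaleZeroTopFrame`, generic in the sampled symbol) at cutoff `Λ_1`.  Hence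

  `D_1 = map (toLin' T⁺_0) (map (toLin' 𝟙²) Y_1)`,

`𝟙² (y, c) y′ = [y = y′]` the trivial doubling (`…TwoVolumeDoubledRowsOne`) and `T⁺_0 = (ε•E(F_0)·S_N) ⊕ (ε•E_plain|₀·S_N)` the block substitution from the doubled
grid legs to `SrcLabel V M 0` — exactly the shape `…TwoVolumeGridSrcSectorScaleSucc.gridSrcSector_sum_norm_kernel_twoVolume_scaleSucc_le` (M3d-grid, p586185)
transfers through; its alive block periodises by `gridOverlap_periodise_leg` (p582110) and so does its source block (the same lemma with the trivial
one-sector family).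

* `smul_klSrcAnalysisAt_mul_apply` — the rows of `(ε • klSrcAnalysisAt … J) · S` in doubled-rows form;
* **`klSrcTower_one_eq_map_doubleBlock_doubleOne`** — the displayed identity (any `e₀`-scale index `j` in fact: `D_j`'s grid presentation at cutoff `Λ_j`).

Proofs only; no definition.  References: BGM 2006 §2.1 (2.5), §2.7 (2.70)–(2.71), §2.9 (4.3)–(4.6).
-/

noncomputable section

namespace Summit.HubbardSuperconductivity.HubbardSuperconductivity.Theorems.TwoVolumeDefect

set_option linter.dupNamespace false -- summit = problem name (single-conjunct summit), D-0017

open Finset Literature.MathematicalPhysics.QuantumLattice GrassmannAlgebra Literature.Probability.LatticeModels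
open Summit.HubbardSuperconductivity.HubbardSuperconductivity.Theorems.KLProgrammeLegKernels
open Summit.HubbardSuperconductivity.HubbardSuperconductivity.Theorems.KLRegimeSplit
open Summit.HubbardSuperconductivity.HubbardSuperconductivity.Theorems.EngineV8
open Summit.HubbardSuperconductivity.HubbardSuperconductivity.Theorems.TwoVolumeSource

variable {L M : ℕ} [NeZero L] [NeZero M]

omit [NeZero M] in
/-- **The rows of `(ε • klSrcAnalysisAt … J) · S` in doubled-rows form**: copy `0` ↦ `((ε • E(F_J)) · S)`, copy `1` ↦ `(B · S)` with `B` the ε-scaled plain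
source block. [folklore] -/
theorem smul_klSrcAnalysisAt_mul_apply {Γ₁ : Type*} [Fintype Γ₁] (β μ : ℝ) (K : TrigPolyC4v) (J : ℕ) (S : Matrix (HubbardFieldIdx L M) Γ₁ ℂ)
    (p : SrcLabel L M J) (y : Γ₁) :
    (((((imagTimeWeight β M : ℝ) : ℂ)) • klSrcAnalysisAt L M β μ K J) * S) p y =
      if p.2 = 0 then (((((imagTimeWeight β M : ℝ) : ℂ)) • sectorAnalysisMatrix L M β (klAnisoFamily L M β μ K klE0 J)) * S) p.1 y
      else ((Matrix.of fun (Y : SpaceTimeIdx L M × SectorLeg (sectorCount J)) (X : HubbardFieldIdx L M) =>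
        if (Y.2.1.1 : ℕ) = 0 then (((imagTimeWeight β M : ℝ) : ℂ)) *
          sectorAnalysisMatrix L M β (trivialMultiplier L M) (Y.1, (((0 : Fin 1), Y.2.1.2), Y.2.2)) X else 0) * S) p.1 y := by
  simp only [Matrix.mul_apply, klSrcAnalysisAt_smul_apply, Matrix.of_apply]
  by_cases h0 : p.2 = 0
  · simp only [h0, if_true]
  · simp only [h0, if_false]

/-- **THE BASE OF THE DOUBLED TOWER**: for every scale index `j`, cutoff `M`, grid `N` (`4M ≤ N+1`, `2M ≤ N`), frame `K`, `β ≠ 0`: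
`map (toLin' (ε • klSrcAnalysisAt … J)) 𝒱_j[K] = map (toLin' T⁺) (map (toLin' 𝟙²) Y_j)` with `Y_j = effAction (S_NᵀC^K_{>Λ_j}S_N)(V_N + 𝒩_K)`, `𝟙²` the trivial
doubling and `T⁺ = ((ε•E(F_J))·S_N) ⊕ (B·S_N)` (explicit matrices by defining hypotheses). [cite: BenfattoGiulianiMastropietro2006, §2.7 (2.70)-(2.71)] -/
theorem klSrcTower_eq_map_doubleBlock_doubleOne {N : ℕ} [NeZero N] {β : ℝ} (hβ : β ≠ 0) (U μ : ℝ) (K : TrigPolyC4v) (J j : ℕ)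
    (hN : 4 * M ≤ N + 1) (hN2 : 2 * M ≤ N)
    (M₁₁ : Matrix (GridLeg (GridPoint L N) × Fin 2) (GridLeg (GridPoint L N)) ℂ) (hM₁₁ : ∀ p y, M₁₁ p y = if p.1 = y then 1 else 0)
    (Tp : Matrix (SrcLabel L M J) (GridLeg (GridPoint L N) × Fin 2) ℂ)
    (hTp : ∀ p' p, Tp p' p = if p'.2 = 0 ∧ p.2 = 0 then
        ((((imagTimeWeight β M : ℝ) : ℂ) • sectorAnalysisMatrix L M β (klAnisoFamily L M β μ K klE0 J)) * hubbardGridSub L M β N) p'.1 p.1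
      else if p'.2 = 1 ∧ p.2 = 1 then
        ((Matrix.of fun (Y : SpaceTimeIdx L M × SectorLeg (sectorCount J)) (X : HubbardFieldIdx L M) =>
          if (Y.2.1.1 : ℕ) = 0 then (((imagTimeWeight β M : ℝ) : ℂ)) *
            sectorAnalysisMatrix L M β (trivialMultiplier L M) (Y.1, (((0 : Fin 1), Y.2.1.2), Y.2.2)) X else 0) * hubbardGridSub L M β N) p'.1 p.1
      else 0) :
    ExteriorAlgebra.map (Matrix.toLin' ((((imagTimeWeight β M : ℝ) : ℂ)) • klSrcAnalysisAt L M β μ K J)) (klEffectiveAction L M β U μ K klE0 j) =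
      ExteriorAlgebra.map (Matrix.toLin' Tp) (ExteriorAlgebra.map (Matrix.toLin' M₁₁)
        (effAction ℂ ((hubbardGridSub L M β N).transpose * hubbardCovAboveCT L M β μ 0 K (klScale klE0 j) * hubbardGridSub L M β N)
          (hubbardGridInteraction L N β U + hubbardGridCounterQuadratic L N β K))) := by
  -- the UV end in the grid presentation
  rw [klEffectiveAction_eq_map_gridSub (L := L) (M := M) hβ U μ K klE0 j hN hN2, map_map_eq_map_comp, ← Matrix.toLin'_mul]
  -- the re-analysis is ONE block substitution of the trivially doubled grid action
  set A' := (((imagTimeWeight β M : ℝ) : ℂ) • sectorAnalysisMatrix L M β (klAnisoFamily L M β μ K klE0 J)) * hubbardGridSub L M β N with hA'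
  set B' := (Matrix.of fun (Y : SpaceTimeIdx L M × SectorLeg (sectorCount J)) (X : HubbardFieldIdx L M) =>
      if (Y.2.1.1 : ℕ) = 0 then (((imagTimeWeight β M : ℝ) : ℂ)) *
        sectorAnalysisMatrix L M β (trivialMultiplier L M) (Y.1, (((0 : Fin 1), Y.2.1.2), Y.2.2)) X else 0) * hubbardGridSub L M β N with hB'
  refine map_doubleRows_eq_map_doubleBlock_map (Γ := GridLeg (GridPoint L N)) A' B' Tp hTp (1 : Matrix _ _ ℂ) A' (1 : Matrix _ _ ℂ) B'
    (Matrix.mul_one _) (Matrix.mul_one _) M₁₁ (fun p X => by rw [hM₁₁, Matrix.one_apply]; split_ifs <;> rfl) _ (fun p' X => ?_) _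
  rw [smul_klSrcAnalysisAt_mul_apply]

end Summit.HubbardSuperconductivity.HubbardSuperconductivity.Theorems.TwoVolumeDefect

end
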